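/-
Copyright (c) 2026 the pub-hodgecm-mathlib formalisation cell (harness21).  Prover seat hodgecm-mathlib-LH5-p04 (g9), 2026-09-03.  E1 row 22 «SS-LEVEL GROUPS (U1)–(U4), LATTICE MODEL»
(E1 keeper ∕ dealer F0P3a-p03 (g29) 00:36:36Z; census E1 v1 §1 (R-SS) objects + §2-K1 MISSING (U)).
-/
import Literature.NumberTheory.Automorphic.UnitaryLatticeTreeFixedVertex   -- ★ `scaleLattice_mono`, `scaleLattice_scaleLattice`, `scaleLattice_le_self_of_v_le_one`; brings ★ `UnitaryLatticeTreeTypes` (`mem_scaleLattice_iff`) and ★ T1a `UnitaryLatticeTreeDefs` (`latt`, `mapGL`, `scaleLattice`)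
import Literature.NumberTheory.Automorphic.UnitaryLatticeTreeLevelShift    -- ★ `mapGL_eq_and_level_iff_map_levelShift_le`, `map_levelShift_latt_le_iff`, `map_sub_one_latt_le_scaleLattice_iff` (the stabiliser clause is automatic on `latt g₀`)
import HarnessLib

/-!
# The lattice graph of a hermitian space — THE SCHNEIDER–STUHLER LEVEL GROUPS `U_M^{(e)} = {g : (g − 1)M ⊆ ϖ^e M}` OF A LATTICE: (U1) subgroup, (U2) antitone in `e`,
# (U3) normalised by the stabiliser, (U4) adjacent nesting along an edge, (U4′) trivial action on `M ∕ ϖ^e M`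

Topic `NumberTheory/Automorphic`; namespace `Literature.NumberTheory.Automorphic.UnitaryLatticeTree` (T1a currency of ★ `UnitaryLatticeTreeDefs`: `[Valued K ℤᵐ⁰]`, lattices
`M : Submodule 𝒪[K] (Fin N → K)`, `mapGL g M = g·M`, `scaleLattice c M = c·M`, `latt g = g·𝒪^N`).  THEOREMS ONLY (no definition, no instance, no notation, no named fact,
no `sorry`); any `N`, any valued field `K`, any `g ∈ GL_N(K)` (the unitary level groups are the `subgroupOf` restrictions — nothing here uses a form).  Cell `pub/hodgecm-mathlib`
(D-0151), crux H413 = `stmt-HodgeConjecture-24833`; E1 row 22 of the E1 RESIDUE MATRIX (keeper F0P3a-p03 (g29) 00:36:36Z: «in the `UnitaryLatticeTree*` currency, for a vertex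
lattice `M` and `e ≥ 1` the level set `U_M^{(e)} := {u : (u − 1) M ⊆ ϖ^e M}` (hypothesis-style set ∕ subgroup, NO def): (U1) closed under `mul` ∕ `inv` ∕ contains `1` (a subgroup
of the stabiliser `P_M`); (U2) antitone in `e`; (U3) normalised by `Stab(M)`; (U4) ADJACENT NESTING for an edge `M ⊋ M′ ⊋ ϖM`: `U_M^{(e+1)} ⊆ U_{M′}^{(e)} ⊆ U_M^{(e−1)}`; (U4′)
`U_M^{(e)}` acts trivially on `M ∕ ϖ^e M`»).  Seat LH5-p04 (g9).  HONEST LABEL: count-neutral generic base layer of the (R-SS) resolution engine (census E1 v1 §1–§2); HC_CM is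
proved only modulo the 2 remaining named inputs (hLiu418 24832, h413 24833) until rung 0 closes; nothing printed is asserted here — this is linear algebra over a valuation ring.

THE LEVEL TOKEN.  Throughout, «`g` has level `c` on `M`» is the tree's token (★ `UnitaryLatticeTreeLevelShift`, ★ `UnitaryLatticeTreeFormTransport.map_conj_sub_one_le_scaleLattice_iff`,
★ p847156 `hlev`), written INLINE and never named:
  `LEV(M, c, g) :≡ M.map ((Matrix.toLin' ((g : Matrix (Fin N) (Fin N) K) - 1)).restrictScalars 𝒪[K]) ≤ scaleLattice c M`   («`(g − 1)·M ⊆ c·M`»),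
and the Schneider–Stuhler level group of the vertex `x = [M]` at depth `e` is the SET `{g | g·M = M ∧ LEV(M, ϖ^e, g)}` [SS97, I.2] — on a genuine lattice `M = latt g₀` and for
`0 < |c| < 1` the clause `g·M = M` is AUTOMATIC (§1, from ★ `mapGL_eq_and_level_iff_map_levelShift_le`), so both spellings are offered.  A consumer who wants the subgroup as an
OBJECT takes it from §1's `∃ U : Subgroup (GL (Fin N) K), ∀ g, g ∈ U ↔ …` (the tree's hypothesis style, cf. ★ (G1) `hKv : ∀ g, g ∈ Kv ↔ …`).

* §0 `map_sub_one_le_scaleLattice_iff_forall_sub_mem` — `LEV(M, c, g) ↔ ∀ m ∈ M, g·m − m ∈ c·M`; (U4′) `map_sub_one_le_scaleLattice_iff_forall_mkQ_eq` — `↔ g` acts trivially on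
  `M` modulo `c·M` (`mkQ (g·m) = mkQ m` in `K^N ∕ c·M`).
* §1 (U1) `map_sub_one_le_scaleLattice_one` (`1 ∈ U`), `mapGL_le_of_map_sub_one_le_scaleLattice` (`|c| ≤ 1 ⇒ g·M ⊆ M`), bookkeeping `mulVec_mem_mapGL` ∕ `smul_mem_scaleLattice_iff` ∕
  `scaleLattice_injective`, `map_sub_one_le_scaleLattice_mul` (closed under `*`
  given `g·M ⊆ M`), `map_sub_one_le_scaleLattice_inv` (closed under `⁻¹` given `g·M = M`), `mapGL_latt_eq_of_map_sub_one_le_scaleLattice` (`0 < |c| < 1`, `M = latt g₀` ⇒ `g·M = M`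
  automatic), `exists_subgroup_mem_iff_mapGL_eq_and_map_sub_one_le_scaleLattice` (the level group WITH the stabiliser clause is a subgroup — every `M`, every `c`),
  `exists_subgroup_mem_iff_map_sub_one_latt_le_scaleLattice` (the PURE level set on `latt g₀` is a subgroup, `0 < |c| < 1`), `mapGL_eq_of_mem_of_mem_iff_map_sub_one_latt_le_scaleLattice`
  (it lies in the stabiliser `P_M`).
* §2 (U2) `map_sub_one_le_scaleLattice_pow_of_le` (`e ≤ e′`, `|ϖ| ≤ 1`: `LEV(M, ϖ^{e′}, g) ⇒ LEV(M, ϖ^e, g)`), `subgroup_le_of_mem_iff_of_le` (`U^{(e′)} ≤ U^{(e)}`).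
* §3 (U3) `map_sub_one_le_scaleLattice_conj` (`s·M = M ⇒ LEV(M, c, g) → LEV(M, c, sgs⁻¹)`), `map_conj_eq_of_mem_iff_of_mapGL_eq` (`Stab(M)` normalises `U`).
* §4 (U4) for `ϖM ≤ M′ ≤ M` (an edge `M — M′` of the lattice graph, strictness not needed): `map_sub_one_le_scaleLattice_pow_of_pow_succ_of_le_of_scaleLattice_le`
  (`LEV(M, ϖ^{e+1}, g) ⇒ LEV(M′, ϖ^e, g)`), `map_sub_one_le_scaleLattice_pow_of_pow_succ_of_le_of_scaleLattice_le'` (`LEV(M′, ϖ^{e+1}, g) ⇒ LEV(M, ϖ^e, g)`, `ϖ ≠ 0`),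
  `mapGL_le_of_le_of_scaleLattice_le_of_map_sub_one_le_scaleLattice` (a level-`≥ 1` element maps `M′` into itself), `mapGL_eq_of_mapGL_eq_of_le_of_scaleLattice_le` ∕
  `mapGL_eq_of_mapGL_eq_of_le_of_scaleLattice_le'` (the stabiliser clause transfers both ways at level `≥ 1`),
  `subgroup_le_of_mem_iff_succ_of_le_of_scaleLattice_le` ∕ `…'` (`U_M^{(e+1)} ≤ U_{M′}^{(e)}` and `U_{M′}^{(e+1)} ≤ U_M^{(e)}`).
EXCLUDED tonight (keeper's deal): (U6) product ∕ Iwahori factorisation and (U7) geodesic inclusion.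

## References
* [SchneiderStuhler1997] P. Schneider, U. Stuhler, *Representation theory and sheaves on the Bruhat–Tits building*, Publ. Math. IHÉS 85 (1997): Ch. I §2 (the groups `U_σ^{(e)}`,
  properties (U1)–(U4)).
* [Korman2004] J. Korman, *On the local constancy of characters*, arXiv:math/0409292: §3.6 (the level groups in the lattice model of `GL_N` ∕ classical groups).
* [Serre1980Trees] J.-P. Serre, *Trees* (1980): Ch. II §1.1–1.2 (lattices, stabilisers, congruence level).
* [BruhatTits1972] F. Bruhat, J. Tits, *Groupes réductifs sur un corps local* I, Publ. Math. IHÉS 41 (1972): §10 (lattice description of the building of a classical group).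
-/

set_option autoImplicit false

noncomputable section

open scoped Valued WithZero Matrix MatrixGroups

namespace Literature.NumberTheory.Automorphic.UnitaryLatticeTree

open Literature.NumberTheory.Automorphic Literature.NumberTheory.Automorphic.HermitianLattice

variable {K : Type*} [Field K] [Valued K ℤᵐ⁰] {N : ℕ}

/-! ## §0 The level token pointwise; (U4′) trivial action modulo `c·M` -/

/-- **THE LEVEL TOKEN POINTWISE**: `(g − 1)·M ⊆ c·M ↔ g·m − m ∈ c·M` for every `m ∈ M`. [cite: SchneiderStuhler1997, Ch. I §2] [cite: Serre1980Trees, Ch. II §1.1] -/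
theorem map_sub_one_le_scaleLattice_iff_forall_sub_mem (g : GL (Fin N) K) (c : K) (M : Submodule 𝒪[K] (Fin N → K)) :
    M.map ((Matrix.toLin' ((g : Matrix (Fin N) (Fin N) K) - 1)).restrictScalars 𝒪[K]) ≤ scaleLattice c M ↔
      ∀ m ∈ M, (g : Matrix (Fin N) (Fin N) K) *ᵥ m - m ∈ scaleLattice c M := by
  constructor
  · intro h m hm
    have h1 := h (Submodule.mem_map_of_mem (f := (Matrix.toLin' ((g : Matrix (Fin N) (Fin N) K) - 1)).restrictScalars 𝒪[K]) hm)
    rwa [LinearMap.restrictScalars_apply, Matrix.toLin'_apply, Matrix.sub_mulVec, Matrix.one_mulVec] at h1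
  · intro h
    rintro _ ⟨m, hm, rfl⟩
    rw [LinearMap.restrictScalars_apply, Matrix.toLin'_apply, Matrix.sub_mulVec, Matrix.one_mulVec]
    exact h m hm

/-- **(U4′) TRIVIAL ACTION ON `M ∕ c·M`**: `(g − 1)·M ⊆ c·M ↔ g·m ≡ m (mod c·M)` for every `m ∈ M` (classes in `K^N ∕ c·M`). [cite: SchneiderStuhler1997, Ch. I §2 (U4′)]
[cite: Korman2004, §3.6] -/
theorem map_sub_one_le_scaleLattice_iff_forall_mkQ_eq (g : GL (Fin N) K) (c : K) (M : Submodule 𝒪[K] (Fin N → K)) :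
    M.map ((Matrix.toLin' ((g : Matrix (Fin N) (Fin N) K) - 1)).restrictScalars 𝒪[K]) ≤ scaleLattice c M ↔
      ∀ m ∈ M, (scaleLattice c M).mkQ ((g : Matrix (Fin N) (Fin N) K) *ᵥ m) = (scaleLattice c M).mkQ m := by
  rw [map_sub_one_le_scaleLattice_iff_forall_sub_mem]
  refine forall₂_congr fun m _ => ?_
  rw [Submodule.mkQ_apply, Submodule.mkQ_apply, Submodule.Quotient.eq]

/-! ## §1 (U1) The level set is a subgroup of the stabiliser -/

/-- **`1` has every level**: `(1 − 1)·M = 0 ⊆ c·M`. [cite: SchneiderStuhler1997, Ch. I §2 (U1)] -/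
theorem map_sub_one_le_scaleLattice_one (c : K) (M : Submodule 𝒪[K] (Fin N → K)) :
    M.map ((Matrix.toLin' (((1 : GL (Fin N) K) : Matrix (Fin N) (Fin N) K) - 1)).restrictScalars 𝒪[K]) ≤ scaleLattice c M := by
  rw [map_sub_one_le_scaleLattice_iff_forall_sub_mem]
  intro m _
  rw [Units.val_one, Matrix.one_mulVec, sub_self]
  exact Submodule.zero_mem _

/-- **A level-`c` element maps `M` into itself** when `|c| ≤ 1`: `g·m = m + (g − 1)·m ∈ M + c·M ⊆ M`. [cite: SchneiderStuhler1997, Ch. I §2 (U1)] [cite: Serre1980Trees, Ch. II §1.2] -/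
theorem mapGL_le_of_map_sub_one_le_scaleLattice {c : K} (hc : Valued.v c ≤ 1) {g : GL (Fin N) K} {M : Submodule 𝒪[K] (Fin N → K)}
    (h : M.map ((Matrix.toLin' ((g : Matrix (Fin N) (Fin N) K) - 1)).restrictScalars 𝒪[K]) ≤ scaleLattice c M) : mapGL g M ≤ M := by
  rw [map_sub_one_le_scaleLattice_iff_forall_sub_mem] at h
  intro x hx
  rw [mapGL, Submodule.mem_map] at hx
  obtain ⟨m, hm, rfl⟩ := hx
  rw [LinearMap.restrictScalars_apply, Matrix.toLin'_apply, ← sub_add_cancel ((g : Matrix (Fin N) (Fin N) K) *ᵥ m) m]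
  exact M.add_mem (scaleLattice_le_self_of_v_le_one hc M (h m hm)) hm

/-- `g·y ∈ g·P` for `y ∈ P`. [cite: Serre1980Trees, Ch. II §1.1] -/
theorem mulVec_mem_mapGL (g : GL (Fin N) K) {P : Submodule 𝒪[K] (Fin N → K)} {y : Fin N → K} (hy : y ∈ P) :
    (g : Matrix (Fin N) (Fin N) K) *ᵥ y ∈ mapGL g P := by
  rw [mapGL]
  exact Submodule.mem_map_of_mem (f := (Matrix.toLin' (g : Matrix (Fin N) (Fin N) K)).restrictScalars 𝒪[K]) hy

/-- `x ∈ P ↔ c·x ∈ c·P` (`c ≠ 0`). [cite: Serre1980Trees, Ch. II §1.1] -/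
theorem smul_mem_scaleLattice_iff {c : K} (hc : c ≠ 0) (P : Submodule 𝒪[K] (Fin N → K)) (x : Fin N → K) : c • x ∈ scaleLattice c P ↔ x ∈ P := by
  rw [mem_scaleLattice_iff hc, smul_smul, inv_mul_cancel₀ hc, one_smul]

/-- Scaling by `c ≠ 0` is injective on lattices. [cite: Serre1980Trees, Ch. II §1.1] -/
theorem scaleLattice_injective {c : K} (hc : c ≠ 0) : Function.Injective (scaleLattice c : Submodule 𝒪[K] (Fin N → K) → Submodule 𝒪[K] (Fin N → K)) := by
  intro P Q h
  ext x
  rw [← smul_mem_scaleLattice_iff hc P x, ← smul_mem_scaleLattice_iff hc Q x, h]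

/-- **(U1) CLOSED UNDER PRODUCTS**: if `g·M ⊆ M` and `g`, `h` have level `c` on `M` then so has `gh` (`(gh − 1)m = g((h − 1)m) + (g − 1)m ∈ g(c·M) + c·M ⊆ c·M`).
[cite: SchneiderStuhler1997, Ch. I §2 (U1)] [cite: Korman2004, §3.6] -/
theorem map_sub_one_le_scaleLattice_mul {c : K} {g h : GL (Fin N) K} {M : Submodule 𝒪[K] (Fin N → K)} (hgM : mapGL g M ≤ M)
    (hg : M.map ((Matrix.toLin' ((g : Matrix (Fin N) (Fin N) K) - 1)).restrictScalars 𝒪[K]) ≤ scaleLattice c M)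
    (hh : M.map ((Matrix.toLin' ((h : Matrix (Fin N) (Fin N) K) - 1)).restrictScalars 𝒪[K]) ≤ scaleLattice c M) :
    M.map ((Matrix.toLin' (((g * h : GL (Fin N) K) : Matrix (Fin N) (Fin N) K) - 1)).restrictScalars 𝒪[K]) ≤ scaleLattice c M := by
  rw [map_sub_one_le_scaleLattice_iff_forall_sub_mem] at hg hh ⊢
  intro m hm
  have hsplit : ((g * h : GL (Fin N) K) : Matrix (Fin N) (Fin N) K) *ᵥ m - m =
      (g : Matrix (Fin N) (Fin N) K) *ᵥ ((h : Matrix (Fin N) (Fin N) K) *ᵥ m - m) + ((g : Matrix (Fin N) (Fin N) K) *ᵥ m - m) := by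
    rw [Units.val_mul, ← Matrix.mulVec_mulVec, Matrix.mulVec_sub]; abel
  rw [hsplit]
  refine (scaleLattice c M).add_mem ?_ (hg m hm)
  have h1 : (g : Matrix (Fin N) (Fin N) K) *ᵥ ((h : Matrix (Fin N) (Fin N) K) *ᵥ m - m) ∈ mapGL g (scaleLattice c M) := mulVec_mem_mapGL g (hh m hm)
  rw [mapGL_scaleLattice] at h1
  exact scaleLattice_mono c hgM h1

/-- **(U1) CLOSED UNDER INVERSES**: if `g·M = M` and `g` has level `c` on `M` then so has `g⁻¹` (`(g⁻¹ − 1)m = −g⁻¹((g − 1)m) ∈ g⁻¹(c·M) = c·M`).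
[cite: SchneiderStuhler1997, Ch. I §2 (U1)] [cite: Korman2004, §3.6] -/
theorem map_sub_one_le_scaleLattice_inv {c : K} {g : GL (Fin N) K} {M : Submodule 𝒪[K] (Fin N → K)} (hgM : mapGL g M = M)
    (hg : M.map ((Matrix.toLin' ((g : Matrix (Fin N) (Fin N) K) - 1)).restrictScalars 𝒪[K]) ≤ scaleLattice c M) :
    M.map ((Matrix.toLin' (((g⁻¹ : GL (Fin N) K) : Matrix (Fin N) (Fin N) K) - 1)).restrictScalars 𝒪[K]) ≤ scaleLattice c M := by
  rw [map_sub_one_le_scaleLattice_iff_forall_sub_mem] at hg ⊢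
  intro m hm
  rw [← hgM, mapGL, Submodule.mem_map] at hm
  obtain ⟨m', hm', rfl⟩ := hm
  rw [LinearMap.restrictScalars_apply, Matrix.toLin'_apply, Matrix.mulVec_mulVec, Units.inv_mul, Matrix.one_mulVec, ← neg_sub]
  exact (scaleLattice c M).neg_mem (hg m' hm')

/-- **THE STABILISER CLAUSE IS AUTOMATIC ON A LATTICE**: for `M = latt g₀` (`g₀ ∈ GL_N(K)`) and `0 < |c| < 1`, `(γ − 1)·M ⊆ c·M ⇒ γ·M = M` (★ `mapGL_eq_and_level_iff_map_levelShift_le`: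
`g₀⁻¹γg₀ ≡ 1 (mod c)` has unit determinant and an integral inverse). [cite: SchneiderStuhler1997, Ch. I §2 (U1)] [cite: Serre1980Trees, Ch. II §1.2] -/
theorem mapGL_latt_eq_of_map_sub_one_le_scaleLattice {c : K} (hc : c ≠ 0) (hc1 : Valued.v c < 1) (γ g₀ : GL (Fin N) K)
    (h : (latt (g₀ : Matrix (Fin N) (Fin N) K)).map ((Matrix.toLin' ((γ : Matrix (Fin N) (Fin N) K) - 1)).restrictScalars 𝒪[K]) ≤ scaleLattice c (latt (g₀ : Matrix (Fin N) (Fin N) K))) :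
    mapGL γ (latt (g₀ : Matrix (Fin N) (Fin N) K)) = latt (g₀ : Matrix (Fin N) (Fin N) K) := by
  exact ((mapGL_eq_and_level_iff_map_levelShift_le hc hc1 γ g₀).2
    ((map_levelShift_latt_le_iff hc γ g₀).2 ((map_sub_one_latt_le_scaleLattice_iff hc γ g₀).1 h))).1

/-- **(U1) THE LEVEL GROUP OF `M` AT `c` IS A SUBGROUP** (with the stabiliser clause — every `M`, every `c`): there is `U ≤ GL_N(K)` with `g ∈ U ↔ g·M = M ∧ (g − 1)·M ⊆ c·M`.
[cite: SchneiderStuhler1997, Ch. I §2 (U1)] [cite: Korman2004, §3.6] -/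
theorem exists_subgroup_mem_iff_mapGL_eq_and_map_sub_one_le_scaleLattice (c : K) (M : Submodule 𝒪[K] (Fin N → K)) :
    ∃ U : Subgroup (GL (Fin N) K), ∀ g : GL (Fin N) K, g ∈ U ↔ mapGL g M = M ∧
      M.map ((Matrix.toLin' ((g : Matrix (Fin N) (Fin N) K) - 1)).restrictScalars 𝒪[K]) ≤ scaleLattice c M := by
  let S : Set (GL (Fin N) K) := {g | mapGL g M = M ∧ M.map ((Matrix.toLin' ((g : Matrix (Fin N) (Fin N) K) - 1)).restrictScalars 𝒪[K]) ≤ scaleLattice c M}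
  have h1 : (1 : GL (Fin N) K) ∈ S := ⟨mapGL_one M, map_sub_one_le_scaleLattice_one c M⟩
  refine ⟨{ carrier := S, mul_mem' := ?_, one_mem' := h1, inv_mem' := ?_ }, fun g => Iff.rfl⟩
  · rintro a b ⟨ha, ha'⟩ ⟨hb, hb'⟩
    exact ⟨by rw [mapGL_mul, hb, ha], map_sub_one_le_scaleLattice_mul ha.le ha' hb'⟩
  · rintro a ⟨ha, ha'⟩
    exact ⟨mapGL_injective a (by rw [← mapGL_mul, mul_inv_cancel, mapGL_one, ha]), map_sub_one_le_scaleLattice_inv ha ha'⟩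

/-- **(U1) THE PURE LEVEL SET OF A LATTICE IS A SUBGROUP**: for `M = latt g₀` and `0 < |c| < 1` there is `U ≤ GL_N(K)` with `γ ∈ U ↔ (γ − 1)·M ⊆ c·M` (the clause `γ·M = M` being automatic).
[cite: SchneiderStuhler1997, Ch. I §2 (U1)] [cite: Korman2004, §3.6] -/
theorem exists_subgroup_mem_iff_map_sub_one_latt_le_scaleLattice {c : K} (hc : c ≠ 0) (hc1 : Valued.v c < 1) (g₀ : GL (Fin N) K) :
    ∃ U : Subgroup (GL (Fin N) K), ∀ γ : GL (Fin N) K, γ ∈ U ↔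
      (latt (g₀ : Matrix (Fin N) (Fin N) K)).map ((Matrix.toLin' ((γ : Matrix (Fin N) (Fin N) K) - 1)).restrictScalars 𝒪[K]) ≤ scaleLattice c (latt (g₀ : Matrix (Fin N) (Fin N) K)) := by
  obtain ⟨U, hU⟩ := exists_subgroup_mem_iff_mapGL_eq_and_map_sub_one_le_scaleLattice c (latt (g₀ : Matrix (Fin N) (Fin N) K))
  exact ⟨U, fun γ => (hU γ).trans ⟨fun h => h.2, fun h => ⟨mapGL_latt_eq_of_map_sub_one_le_scaleLattice hc hc1 γ g₀ h, h⟩⟩⟩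

/-- **(U1) … AND IT LIES IN THE STABILISER `P_M`**: every member of a subgroup cut out by the pure level token on `M = latt g₀` (`0 < |c| < 1`) fixes `M`.
[cite: SchneiderStuhler1997, Ch. I §2 (U1)] [cite: BruhatTits1972, §10] -/
theorem mapGL_eq_of_mem_of_mem_iff_map_sub_one_latt_le_scaleLattice {c : K} (hc : c ≠ 0) (hc1 : Valued.v c < 1) (g₀ : GL (Fin N) K) {U : Subgroup (GL (Fin N) K)}
    (hU : ∀ γ : GL (Fin N) K, γ ∈ U ↔
      (latt (g₀ : Matrix (Fin N) (Fin N) K)).map ((Matrix.toLin' ((γ : Matrix (Fin N) (Fin N) K) - 1)).restrictScalars 𝒪[K]) ≤ scaleLattice c (latt (g₀ : Matrix (Fin N) (Fin N) K)))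
    {γ : GL (Fin N) K} (hγ : γ ∈ U) : mapGL γ (latt (g₀ : Matrix (Fin N) (Fin N) K)) = latt (g₀ : Matrix (Fin N) (Fin N) K) := by
  exact mapGL_latt_eq_of_map_sub_one_le_scaleLattice hc hc1 γ g₀ ((hU γ).1 hγ)

/-! ## §2 (U2) Antitone in the depth `e` -/

/-- **(U2) ANTITONE IN `e`**: for `|ϖ| ≤ 1` and `e ≤ e′`, level `ϖ^{e′}` implies level `ϖ^e` (`ϖ^{e′}·M ⊆ ϖ^e·M`). [cite: SchneiderStuhler1997, Ch. I §2 (U2)] [cite: Korman2004, §3.6] -/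
theorem map_sub_one_le_scaleLattice_pow_of_le {ϖ : K} (hϖ1 : Valued.v ϖ ≤ 1) {e e' : ℕ} (hee' : e ≤ e') {g : GL (Fin N) K} {M : Submodule 𝒪[K] (Fin N → K)}
    (h : M.map ((Matrix.toLin' ((g : Matrix (Fin N) (Fin N) K) - 1)).restrictScalars 𝒪[K]) ≤ scaleLattice (ϖ ^ e') M) :
    M.map ((Matrix.toLin' ((g : Matrix (Fin N) (Fin N) K) - 1)).restrictScalars 𝒪[K]) ≤ scaleLattice (ϖ ^ e) M := by
  obtain ⟨f, rfl⟩ := Nat.exists_eq_add_of_le hee'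
  refine h.trans ?_
  rw [pow_add, ← scaleLattice_scaleLattice]
  have hf : Valued.v (ϖ ^ f) ≤ 1 := by rw [map_pow]; exact pow_le_one₀ zero_le hϖ1
  exact scaleLattice_mono _ (scaleLattice_le_self_of_v_le_one hf M)

/-- **(U2) `U_M^{(e′)} ≤ U_M^{(e)}` for `e ≤ e′`** (subgroups cut out by the stabiliser clause and the level token at `ϖ^{e′}`, `ϖ^e`; `|ϖ| ≤ 1`).
[cite: SchneiderStuhler1997, Ch. I §2 (U2)] -/
theorem subgroup_le_of_mem_iff_of_le {ϖ : K} (hϖ1 : Valued.v ϖ ≤ 1) {e e' : ℕ} (hee' : e ≤ e') {M : Submodule 𝒪[K] (Fin N → K)} {U U' : Subgroup (GL (Fin N) K)}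
    (hU : ∀ g : GL (Fin N) K, g ∈ U ↔ mapGL g M = M ∧ M.map ((Matrix.toLin' ((g : Matrix (Fin N) (Fin N) K) - 1)).restrictScalars 𝒪[K]) ≤ scaleLattice (ϖ ^ e) M)
    (hU' : ∀ g : GL (Fin N) K, g ∈ U' ↔ mapGL g M = M ∧ M.map ((Matrix.toLin' ((g : Matrix (Fin N) (Fin N) K) - 1)).restrictScalars 𝒪[K]) ≤ scaleLattice (ϖ ^ e') M) :
    U' ≤ U := by
  intro g hg
  obtain ⟨h1, h2⟩ := (hU' g).1 hg
  exact (hU g).2 ⟨h1, map_sub_one_le_scaleLattice_pow_of_le hϖ1 hee' h2⟩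

/-! ## §3 (U3) Normalised by the stabiliser of `M` -/

/-- **(U3) CONJUGATION BY THE STABILISER**: if `s·M = M` and `g` has level `c` on `M`, so has `sgs⁻¹` (`(sgs⁻¹ − 1)·M = s(g − 1)s⁻¹·M = s(g − 1)·M ⊆ s(c·M) = c·M`).
[cite: SchneiderStuhler1997, Ch. I §2 (U3)] [cite: Korman2004, §3.6] -/
theorem map_sub_one_le_scaleLattice_conj {c : K} {s g : GL (Fin N) K} {M : Submodule 𝒪[K] (Fin N → K)} (hs : mapGL s M = M)
    (h : M.map ((Matrix.toLin' ((g : Matrix (Fin N) (Fin N) K) - 1)).restrictScalars 𝒪[K]) ≤ scaleLattice c M) :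
    M.map ((Matrix.toLin' (((s * g * s⁻¹ : GL (Fin N) K) : Matrix (Fin N) (Fin N) K) - 1)).restrictScalars 𝒪[K]) ≤ scaleLattice c M := by
  rw [map_sub_one_le_scaleLattice_iff_forall_sub_mem] at h ⊢
  intro m hm
  rw [← hs, mapGL, Submodule.mem_map] at hm
  obtain ⟨m', hm', rfl⟩ := hm
  rw [LinearMap.restrictScalars_apply, Matrix.toLin'_apply]
  have hconj : ((s * g * s⁻¹ : GL (Fin N) K) : Matrix (Fin N) (Fin N) K) *ᵥ ((s : Matrix (Fin N) (Fin N) K) *ᵥ m') =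
      (s : Matrix (Fin N) (Fin N) K) *ᵥ ((g : Matrix (Fin N) (Fin N) K) *ᵥ m') := by
    rw [Matrix.mulVec_mulVec, Units.val_mul, Units.val_mul, Matrix.mul_assoc, Matrix.mul_assoc, Units.inv_mul, Matrix.mul_one, ← Matrix.mulVec_mulVec]
  rw [hconj, ← Matrix.mulVec_sub]
  have h1 : (s : Matrix (Fin N) (Fin N) K) *ᵥ ((g : Matrix (Fin N) (Fin N) K) *ᵥ m' - m') ∈ mapGL s (scaleLattice c M) := mulVec_mem_mapGL s (h m' hm')
  rwa [mapGL_scaleLattice, hs] at h1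

/-- **(U3) `Stab(M)` NORMALISES THE LEVEL GROUP**: for the subgroup `U` cut out by `g·M = M ∧ (g − 1)·M ⊆ c·M` and any `s` with `s·M = M`, `sUs⁻¹ = U`.
[cite: SchneiderStuhler1997, Ch. I §2 (U3)] [cite: BruhatTits1972, §10] -/
theorem map_conj_eq_of_mem_iff_of_mapGL_eq {c : K} {M : Submodule 𝒪[K] (Fin N → K)} {U : Subgroup (GL (Fin N) K)}
    (hU : ∀ g : GL (Fin N) K, g ∈ U ↔ mapGL g M = M ∧ M.map ((Matrix.toLin' ((g : Matrix (Fin N) (Fin N) K) - 1)).restrictScalars 𝒪[K]) ≤ scaleLattice c M)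
    {s : GL (Fin N) K} (hs : mapGL s M = M) : U.map (MulAut.conj s).toMonoidHom = U := by
  have hs' : mapGL s⁻¹ M = M := mapGL_injective s (by rw [← mapGL_mul, mul_inv_cancel, mapGL_one, hs])
  ext g
  rw [Subgroup.mem_map]
  constructor
  · rintro ⟨x, hx, rfl⟩
    obtain ⟨hx1, hx2⟩ := (hU x).1 hx
    rw [MulEquiv.coe_toMonoidHom, MulAut.conj_apply, hU]
    exact ⟨by rw [mapGL_mul, mapGL_mul, hs', hx1, hs], map_sub_one_le_scaleLattice_conj hs hx2⟩
  · intro hg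
    obtain ⟨hg1, hg2⟩ := (hU g).1 hg
    refine ⟨s⁻¹ * g * s⁻¹⁻¹, (hU _).2 ⟨?_, map_sub_one_le_scaleLattice_conj hs' hg2⟩, ?_⟩
    · rw [inv_inv, mapGL_mul, mapGL_mul, hs, hg1, hs']
    · rw [MulEquiv.coe_toMonoidHom, MulAut.conj_apply, inv_inv]; group

/-! ## §4 (U4) Adjacent nesting along an edge `ϖM ≤ M′ ≤ M` -/

/-- **(U4) `U_M^{(e+1)} ⊆ U_{M′}^{(e)}`, TOKEN FORM**: if `ϖM ⊆ M′ ⊆ M` then `(g − 1)·M ⊆ ϖ^{e+1}·M ⇒ (g − 1)·M′ ⊆ ϖ^e·M′`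
(`(g − 1)M′ ⊆ (g − 1)M ⊆ ϖ^{e+1}M = ϖ^e(ϖM) ⊆ ϖ^e M′`; no hypothesis on `ϖ`). [cite: SchneiderStuhler1997, Ch. I §2 (U4)] [cite: Korman2004, §3.6] -/
theorem map_sub_one_le_scaleLattice_pow_of_pow_succ_of_le_of_scaleLattice_le {ϖ : K} {M M' : Submodule 𝒪[K] (Fin N → K)} (hM'M : M' ≤ M) (hMM' : scaleLattice ϖ M ≤ M')
    {e : ℕ} {g : GL (Fin N) K} (h : M.map ((Matrix.toLin' ((g : Matrix (Fin N) (Fin N) K) - 1)).restrictScalars 𝒪[K]) ≤ scaleLattice (ϖ ^ (e + 1)) M) :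
    M'.map ((Matrix.toLin' ((g : Matrix (Fin N) (Fin N) K) - 1)).restrictScalars 𝒪[K]) ≤ scaleLattice (ϖ ^ e) M' := by
  rw [map_sub_one_le_scaleLattice_iff_forall_sub_mem] at h ⊢
  intro m hm
  have h1 := h m (hM'M hm)
  rw [pow_succ, ← scaleLattice_scaleLattice] at h1
  exact scaleLattice_mono _ hMM' h1

/-- **(U4) `U_{M′}^{(e+1)} ⊆ U_M^{(e)}`, TOKEN FORM**: if `ϖM ⊆ M′ ⊆ M` (`ϖ ≠ 0`) then `(g − 1)·M′ ⊆ ϖ^{e+1}·M′ ⇒ (g − 1)·M ⊆ ϖ^e·M`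
(`M ⊆ ϖ⁻¹M′`, so `(g − 1)M ⊆ ϖ⁻¹(g − 1)M′ ⊆ ϖ⁻¹ϖ^{e+1}M′ = ϖ^e M′ ⊆ ϖ^e M`). [cite: SchneiderStuhler1997, Ch. I §2 (U4)] [cite: Korman2004, §3.6] -/
theorem map_sub_one_le_scaleLattice_pow_of_pow_succ_of_le_of_scaleLattice_le' {ϖ : K} (hϖ : ϖ ≠ 0) {M M' : Submodule 𝒪[K] (Fin N → K)} (hM'M : M' ≤ M)
    (hMM' : scaleLattice ϖ M ≤ M') {e : ℕ} {g : GL (Fin N) K}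
    (h : M'.map ((Matrix.toLin' ((g : Matrix (Fin N) (Fin N) K) - 1)).restrictScalars 𝒪[K]) ≤ scaleLattice (ϖ ^ (e + 1)) M') :
    M.map ((Matrix.toLin' ((g : Matrix (Fin N) (Fin N) K) - 1)).restrictScalars 𝒪[K]) ≤ scaleLattice (ϖ ^ e) M := by
  rw [map_sub_one_le_scaleLattice_iff_forall_sub_mem] at h ⊢
  intro m hm
  have hϖm : ϖ • m ∈ M' := hMM' ((smul_mem_scaleLattice_iff hϖ M m).2 hm)
  have h1 := h (ϖ • m) hϖm
  rw [Matrix.mulVec_smul, ← smul_sub, pow_succ', ← scaleLattice_scaleLattice, smul_mem_scaleLattice_iff hϖ] at h1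
  exact scaleLattice_mono _ hM'M h1

/-- **A LEVEL-`≥ 1` ELEMENT OF THE STABILISER SIDE MAPS `M′` INTO ITSELF**: if `ϖM ⊆ M′ ⊆ M` and `(g − 1)·M ⊆ ϖ·M` then `g·M′ ⊆ M′` (`g·m′ = (g − 1)m′ + m′ ∈ ϖM + M′`).
[cite: SchneiderStuhler1997, Ch. I §2 (U4)] [cite: BruhatTits1972, §10] -/
theorem mapGL_le_of_le_of_scaleLattice_le_of_map_sub_one_le_scaleLattice {ϖ : K} {M M' : Submodule 𝒪[K] (Fin N → K)} (hM'M : M' ≤ M) (hMM' : scaleLattice ϖ M ≤ M')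
    {g : GL (Fin N) K} (h : M.map ((Matrix.toLin' ((g : Matrix (Fin N) (Fin N) K) - 1)).restrictScalars 𝒪[K]) ≤ scaleLattice ϖ M) : mapGL g M' ≤ M' := by
  rw [map_sub_one_le_scaleLattice_iff_forall_sub_mem] at h
  intro x hx
  rw [mapGL, Submodule.mem_map] at hx
  obtain ⟨m, hm, rfl⟩ := hx
  rw [LinearMap.restrictScalars_apply, Matrix.toLin'_apply, ← sub_add_cancel ((g : Matrix (Fin N) (Fin N) K) *ᵥ m) m]
  exact M'.add_mem (hMM' (h m (hM'M hm))) hm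

/-- **(U4) THE STABILISER CLAUSE DESCENDS ALONG THE EDGE**: if `ϖM ⊆ M′ ⊆ M`, `g·M = M` and `(g − 1)·M ⊆ ϖ·M` (level `≥ 1` on `M`), then `g·M′ = M′`
(`g` and `g⁻¹` act trivially on `M ∕ ϖM ⊇ M′ ∕ ϖM`). [cite: SchneiderStuhler1997, Ch. I §2 (U4)] [cite: BruhatTits1972, §10] -/
theorem mapGL_eq_of_mapGL_eq_of_le_of_scaleLattice_le {ϖ : K} {M M' : Submodule 𝒪[K] (Fin N → K)} (hM'M : M' ≤ M) (hMM' : scaleLattice ϖ M ≤ M')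
    {g : GL (Fin N) K} (hgM : mapGL g M = M) (h : M.map ((Matrix.toLin' ((g : Matrix (Fin N) (Fin N) K) - 1)).restrictScalars 𝒪[K]) ≤ scaleLattice ϖ M) :
    mapGL g M' = M' := by
  refine le_antisymm (mapGL_le_of_le_of_scaleLattice_le_of_map_sub_one_le_scaleLattice hM'M hMM' h) ?_
  -- `g⁻¹` has level `ϖ` on `M` too, so `g⁻¹·M′ ⊆ M′`, i.e. `M′ ⊆ g·M′`
  have hinv := mapGL_le_of_le_of_scaleLattice_le_of_map_sub_one_le_scaleLattice hM'M hMM' (map_sub_one_le_scaleLattice_inv hgM h)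
  have h2 := (mapGL_le_mapGL_iff g _ _).2 hinv
  rwa [← mapGL_mul, mul_inv_cancel, mapGL_one] at h2

/-- **(U4) THE STABILISER CLAUSE ASCENDS ALONG THE EDGE**: if `ϖM ⊆ M′ ⊆ M` (`ϖ ≠ 0`), `g·M′ = M′` and `(g − 1)·M′ ⊆ ϖ·M′`, then `g·M = M`
(apply the descent to the edge `ϖM′ ⊆ ϖM ⊆ M′` and unscale). [cite: SchneiderStuhler1997, Ch. I §2 (U4)] [cite: BruhatTits1972, §10] -/
theorem mapGL_eq_of_mapGL_eq_of_le_of_scaleLattice_le' {ϖ : K} (hϖ : ϖ ≠ 0) {M M' : Submodule 𝒪[K] (Fin N → K)} (hM'M : M' ≤ M) (hMM' : scaleLattice ϖ M ≤ M')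
    {g : GL (Fin N) K} (hgM' : mapGL g M' = M') (h : M'.map ((Matrix.toLin' ((g : Matrix (Fin N) (Fin N) K) - 1)).restrictScalars 𝒪[K]) ≤ scaleLattice ϖ M') :
    mapGL g M = M := by
  -- descend along the edge `ϖM′ ⊆ ϖM ⊆ M′`, then unscale by `ϖ`
  have h1 : mapGL g (scaleLattice ϖ M) = scaleLattice ϖ M :=
    mapGL_eq_of_mapGL_eq_of_le_of_scaleLattice_le hMM' (scaleLattice_mono ϖ hM'M) hgM' h
  rw [mapGL_scaleLattice] at h1
  exact scaleLattice_injective hϖ h1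

/-- **(U4) ADJACENT NESTING `U_M^{(e+1)} ≤ U_{M′}^{(e)}`** for an edge `ϖM ⊆ M′ ⊆ M` (`|ϖ| ≤ 1`; subgroups cut out by the stabiliser clause and the level token).
[cite: SchneiderStuhler1997, Ch. I §2 (U4)] [cite: Korman2004, §3.6] -/
theorem subgroup_le_of_mem_iff_succ_of_le_of_scaleLattice_le {ϖ : K} (hϖ1 : Valued.v ϖ ≤ 1) {M M' : Submodule 𝒪[K] (Fin N → K)} (hM'M : M' ≤ M)
    (hMM' : scaleLattice ϖ M ≤ M') {e : ℕ} {U U' : Subgroup (GL (Fin N) K)}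
    (hU : ∀ g : GL (Fin N) K, g ∈ U ↔ mapGL g M = M ∧ M.map ((Matrix.toLin' ((g : Matrix (Fin N) (Fin N) K) - 1)).restrictScalars 𝒪[K]) ≤ scaleLattice (ϖ ^ (e + 1)) M)
    (hU' : ∀ g : GL (Fin N) K, g ∈ U' ↔ mapGL g M' = M' ∧ M'.map ((Matrix.toLin' ((g : Matrix (Fin N) (Fin N) K) - 1)).restrictScalars 𝒪[K]) ≤ scaleLattice (ϖ ^ e) M') :
    U ≤ U' := by
  intro g hg
  obtain ⟨hg1, hg2⟩ := (hU g).1 hg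
  have hg3 : M.map ((Matrix.toLin' ((g : Matrix (Fin N) (Fin N) K) - 1)).restrictScalars 𝒪[K]) ≤ scaleLattice ϖ M := by
    have := map_sub_one_le_scaleLattice_pow_of_le hϖ1 (Nat.succ_le_succ (Nat.zero_le e)) hg2
    rwa [pow_one] at this
  exact (hU' g).2 ⟨mapGL_eq_of_mapGL_eq_of_le_of_scaleLattice_le hM'M hMM' hg1 hg3,
    map_sub_one_le_scaleLattice_pow_of_pow_succ_of_le_of_scaleLattice_le hM'M hMM' hg2⟩

/-- **(U4) ADJACENT NESTING `U_{M′}^{(e+1)} ≤ U_M^{(e)}`** for an edge `ϖM ⊆ M′ ⊆ M` (`0 < |ϖ| ≤ 1`). [cite: SchneiderStuhler1997, Ch. I §2 (U4)] [cite: Korman2004, §3.6] -/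
theorem subgroup_le_of_mem_iff_succ_of_le_of_scaleLattice_le' {ϖ : K} (hϖ : ϖ ≠ 0) (hϖ1 : Valued.v ϖ ≤ 1) {M M' : Submodule 𝒪[K] (Fin N → K)} (hM'M : M' ≤ M)
    (hMM' : scaleLattice ϖ M ≤ M') {e : ℕ} {U U' : Subgroup (GL (Fin N) K)}
    (hU' : ∀ g : GL (Fin N) K, g ∈ U' ↔ mapGL g M' = M' ∧ M'.map ((Matrix.toLin' ((g : Matrix (Fin N) (Fin N) K) - 1)).restrictScalars 𝒪[K]) ≤ scaleLattice (ϖ ^ (e + 1)) M')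
    (hU : ∀ g : GL (Fin N) K, g ∈ U ↔ mapGL g M = M ∧ M.map ((Matrix.toLin' ((g : Matrix (Fin N) (Fin N) K) - 1)).restrictScalars 𝒪[K]) ≤ scaleLattice (ϖ ^ e) M) :
    U' ≤ U := by
  intro g hg
  obtain ⟨hg1, hg2⟩ := (hU' g).1 hg
  have hg3 : M'.map ((Matrix.toLin' ((g : Matrix (Fin N) (Fin N) K) - 1)).restrictScalars 𝒪[K]) ≤ scaleLattice ϖ M' := by
    have := map_sub_one_le_scaleLattice_pow_of_le hϖ1 (Nat.succ_le_succ (Nat.zero_le e)) hg2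
    rwa [pow_one] at this
  exact (hU g).2 ⟨mapGL_eq_of_mapGL_eq_of_le_of_scaleLattice_le' hϖ hM'M hMM' hg1 hg3,
    map_sub_one_le_scaleLattice_pow_of_pow_succ_of_le_of_scaleLattice_le' hϖ hM'M hMM' hg2⟩

end Literature.NumberTheory.Automorphic.UnitaryLatticeTree

end
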